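import Literature.NumberTheory.LFunctions.BurnolSonineEvaluators
import Literature.NumberTheory.LFunctions.BurnolSonineHardyCharacterisationProofs
import HarnessLib

/-!
# Burnol 2004b, Thm. 3.3: the zeta-quotient vectors `ζ(s)/(s−ρ)^l` of `L_1` and their duality with the evaluators `Y¹_{ρ′,k}`

LINE 1 — LABEL: RH-FREE (pairings of two fixed systems of vectors of Burnol's space `L_1`, indexed by
the non-trivial zeros of `ζ` WHEREVER they lie, with their multiplicities `m_ρ`). FRAMING (cell rh-crit,
D-0074): corpus theorems are RH-FREE literature; nothing here is worded as progress toward RH.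
bears_on: B-C/B-P (LADDER-RH COLUMN 6, de Branges framework) as clauses (i), (iv), (v), (vi) of
[Burnol2004b, Thm. 3.3] (`Burnol2004b_thm3_3`, `BurnolZetaSystems.lean`). WHAT THIS IS NOT: not a
route, not a criterion; nothing here bears on the truth of RH.

Source: J.-F. Burnol, JTNB 16 (2004) = arXiv:math/0203120v7, §3 Thm. 3.3 and the computation before
it, TeX of record `dbl/src/Burnol2004JTNB_arXivmath0203120v7.tex` l.566–594: "we note that the
vectors `ζ(s)/(s−ρ)^l`, `1 ≤ l ≤ m_ρ` … belong to `L̂_1` [Prop. 4.2] … `[v_{ρ,l}, Y¹_{ρ′,k}]` is the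
`k`-th derivative of `Γ_ℝ(s)ζ(s)/(s−ρ)^l` at `s = ρ′`: it vanishes if `ρ′ ≠ ρ`, or if `ρ′ = ρ` and
`k < m_ρ − l`, and it does not vanish for `ρ′ = ρ`, `k = m_ρ − l`" (the triangular duality).

## What is proved (theorems only; no definition, no named fact)

* `BurnolZetaDuality.isZetaQuotientVector_zetaQuotientVector` / `_zetaQuotientSystem`,
  `zetaQuotientSystem_mem_sonineL`, `rightMellinExt_zetaQuotientVector` — clause (i): the `ε`-chosen
  zeta-quotient vectors HAVE their defining property (`Burnol2004b_prop4_2_holds`) and their continued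
  transform is `ζ(s)/(s−ρ)^l` (filled in) on `ℂ ∖ {1}`;
* `BurnolZetaDuality.pairing_eq_iteratedDeriv` — `[v_{ρ,l}, Y¹_{ρ′,k}] = (d/ds)^k[Γ_ℝ(s)ζ(s)/(s−ρ)^l]_{s=ρ′}`;
* `BurnolZetaDuality.analyticOrderAt_completedQuotient_of_ne` / `_self` — the order of
  `Γ_ℝ(s)ζ(s)/(s−ρ)^l` at `ρ′` is `m_{ρ′}` (`ρ′ ≠ ρ`) resp. `m_ρ − l` (`ρ′ = ρ`);
* **`Burnol2004b_thm3_3_i`, `Burnol2004b_thm3_3_iv`, `Burnol2004b_thm3_3_v`, `Burnol2004b_thm3_3_vi`**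
  — conjuncts 1, 4, 5, 6 of `Burnol2004b_thm3_3`, verbatim and hypothesis-free. (Conjunct 2,
  minimality, follows from (iv)–(vi) by the triangular inversion; conjunct 3 is Cor. 5.3.)

## References

* J.-F. Burnol, JTNB 16 (2004), Thm. 3.3 (arXiv:math/0203120v7 p. 7, TeX l.566–594). [key `Burnol2004b`]
-/

noncomputable section

open MeasureTheory Complex Filter Set Real
open scoped Topology

namespace Literature.NumberTheory.LFunctions

namespace BurnolZetaDuality

open BurnolZetaHardy BurnolEvaluators

/-! ## Clause (i): the zeta-quotient vectors -/

/-- **The `ε`-chosen `zetaQuotientVector ρ l` IS the inverse Mellin transform of `ζ(s)/(s−ρ)^l` in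
`L_1`** (`ρ` a non-trivial zero, `1 ≤ l ≤ m_ρ`; existence = Prop. 4.2, `Burnol2004b_prop4_2_holds`).
[cite: Burnol2004b, Thm. 3.3 (i) and Prop. 4.2 (arXiv:math/0203120v7 pp. 7–8, TeX l.587–594, 688–691)] -/
theorem isZetaQuotientVector_zetaQuotientVector {ρ : ℂ} (hρ : ρ ∈ ZetaZeros.riemannZetaNontrivialZeros)
    {l : ℕ} (hl : 1 ≤ l) (hlm : (l : ℤ) ≤ riemannZetaZeroOrder ρ) :
    IsZetaQuotientVector ρ l (zetaQuotientVector ρ l) :=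
  Classical.epsilon_spec (p := fun v : Lp ℂ 2 (volume : Measure ℝ) ↦ IsZetaQuotientVector ρ l v)
    (Burnol2004b_prop4_2_holds ρ hρ l hl hlm)

/-- For an index `p = (ρ, k)` of the systems, `l = k + 1` satisfies `1 ≤ l ≤ m_ρ`. [cite: Burnol2004b, §2 Definition (arXiv:math/0203120v7 p. 5, TeX l.486–491)] -/
theorem index_succ_le (p : ZetaZeroIndex) : ((p.1.2 + 1 : ℕ) : ℤ) ≤ riemannZetaZeroOrder p.1.1 := by
  have := p.2.2; push_cast; omega

/-- Every vector of the second system has its defining property. [cite: Burnol2004b, Thm. 3.3 (i) (arXiv:math/0203120v7 p. 7, TeX l.587–594)] -/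
theorem isZetaQuotientVector_zetaQuotientSystem (p : ZetaZeroIndex) :
    IsZetaQuotientVector p.1.1 (p.1.2 + 1) (zetaQuotientSystem p) :=
  isZetaQuotientVector_zetaQuotientVector p.2.1 (Nat.succ_le_succ (Nat.zero_le _)) (index_succ_le p)

/-- The second system lies in `L_1`. [cite: Burnol2004b, Thm. 3.3 (i) (arXiv:math/0203120v7 p. 7, TeX l.587–594)] -/
theorem zetaQuotientSystem_mem_sonineL (p : ZetaZeroIndex) : zetaQuotientSystem p ∈ sonineL 1 :=
  (isZetaQuotientVector_zetaQuotientSystem p).1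

/-- A non-trivial zero is `≠ 1`. [folklore] -/
private theorem ne_one_of_mem {ρ : ℂ} (hρ : ρ ∈ ZetaZeros.riemannZetaNontrivialZeros) : ρ ≠ 1 :=
  (admissible_of_mem_nontrivialZeros hρ).2.1

/-- **The continued transform of `v_{ρ,l}` is `ζ(s)/(s−ρ)^l` on `ℂ ∖ {1}`** (uniqueness of the
continuation from the strip). [cite: Burnol2004b, Thm. 3.3 (i) and §4 Note (arXiv:math/0203120v7 p. 7, TeX l.587–594, 614–623)] -/
theorem rightMellinExt_zetaQuotientVector {ρ : ℂ} (hρ : ρ ∈ ZetaZeros.riemannZetaNontrivialZeros)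
    {l : ℕ} (hl : 1 ≤ l) (hlm : (l : ℤ) ≤ riemannZetaZeroOrder ρ) :
    EqOn (rightMellinExt (zetaQuotientVector ρ l)) (zetaOverPow ρ l) {s | s ≠ 1} := by
  have hv := isZetaQuotientVector_zetaQuotientVector hρ hl hlm
  have hρ1 := ne_one_of_mem hρ
  have hord := natCast_le_analyticOrderAt_zeta hρ1 hlm
  exact (hasRightMellinContinuation_rightMellinExt_of_mem_sonineL one_pos hv.1).eqOn
    ⟨differentiableOn_zetaOverPow hρ1 hord, fun s hs1 hs2 ↦ (hv.2 s hs1 hs2).symm⟩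

/-! ## The pairing `[v_{ρ,l}, Y¹_{ρ′,k}]` -/

/-- **`[v_{ρ,l}, Y¹_{ρ′,k}] = M(v_{ρ,l})^{(k)}(ρ′)`** — the evaluator does its job on `v_{ρ,l} ∈ L_1`
(`isBurnolY_burnolYSystem`). [cite: Burnol2004b, §2 and Thm. 3.3 (arXiv:math/0203120v7 pp. 5, 7; TeX l.464–481, 566–578)] -/
theorem pairing_eq_burnolEval (p q : ZetaZeroIndex) :
    ∫ t in Ioi (0 : ℝ), zetaQuotientSystem p t * burnolYSystem 1 q t =
      burnolEval (zetaQuotientSystem p) q.1.1 q.1.2 :=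
  (isBurnolY_burnolYSystem one_pos q).2 _ (zetaQuotientSystem_mem_sonineL p)

/-- `M(v_{ρ,l})^{(k)}(w) = (d/ds)^k[Γ_ℝ(s)ζ(s)/(s−ρ)^l]_{s=w}` (`w ≠ 1`). [cite: Burnol2004b, Thm. 3.3 (arXiv:math/0203120v7 p. 7, TeX l.566–578)] -/
theorem burnolEval_zetaQuotientSystem (p : ZetaZeroIndex) {w : ℂ} (hw1 : w ≠ 1) (k : ℕ) :
    burnolEval (zetaQuotientSystem p) w k =
      iteratedDeriv k (fun s ↦ Gammaℝ s * zetaOverPow p.1.1 (p.1.2 + 1) s) w := by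
  simp only [burnolEval]
  apply Filter.EventuallyEq.iteratedDeriv_eq
  filter_upwards [isOpen_ne.mem_nhds hw1] with s hs
  simp only [completedMellin]
  rw [show zetaQuotientSystem p = zetaQuotientVector p.1.1 (p.1.2 + 1) from rfl,
    rightMellinExt_zetaQuotientVector p.2.1 (Nat.succ_le_succ (Nat.zero_le _)) (index_succ_le p) hs]

/-- **`[v_{ρ,l}, Y¹_{ρ′,k}] = (d/ds)^k[Γ_ℝ(s)ζ(s)/(s−ρ)^l]_{s=ρ′}`.** [cite: Burnol2004b, Thm. 3.3 (arXiv:math/0203120v7 p. 7, TeX l.566–578)] -/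
theorem pairing_eq_iteratedDeriv (p q : ZetaZeroIndex) :
    ∫ t in Ioi (0 : ℝ), zetaQuotientSystem p t * burnolYSystem 1 q t =
      iteratedDeriv q.1.2 (fun s ↦ Gammaℝ s * zetaOverPow p.1.1 (p.1.2 + 1) s) q.1.1 := by
  rw [pairing_eq_burnolEval, burnolEval_zetaQuotientSystem p (ne_one_of_mem q.2.1)]

/-! ## Orders of `Γ_ℝ(s)ζ(s)/(s−ρ)^l` at the zeros -/

/-- The analytic order of `ζ` at `ρ ≠ 1` is finite. [folklore] -/
private theorem analyticOrderAt_zeta_ne_top {ρ : ℂ} (h : ρ ≠ 1) : analyticOrderAt riemannZeta ρ ≠ ⊤ := by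
  intro htop
  have h2 : riemannZeta 2 = 0 :=
    analyticOn_riemannZeta.eqOn_zero_of_preconnected_of_eventuallyEq_zero
      (isConnected_compl_singleton_of_one_lt_rank (by simp) (1 : ℂ)).isPreconnected h
      (analyticOrderAt_eq_top.mp htop) (show (2 : ℂ) ∈ ({1}ᶜ : Set ℂ) by norm_num)
  exact riemannZeta_ne_zero_of_one_le_re (s := 2) (by norm_num) h2

/-- The analytic order of `ζ` at `ρ ≠ 1` is the multiplicity `m_ρ = riemannZetaZeroOrder ρ` (as a
natural number; "we write `m_ρ` for the multiplicity of `ρ` as a zero of `ζ`").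
[cite: Burnol2004b, §2 Definition and Note 5 (arXiv:math/0203120v7 p. 5, TeX l.486–491, 978–984)] -/
theorem analyticOrderAt_zeta_eq {ρ : ℂ} (h : ρ ≠ 1) :
    analyticOrderAt riemannZeta ρ = ((riemannZetaZeroOrder ρ).toNat : ℕ∞) := by
  have ha : AnalyticAt ℂ riemannZeta ρ := analyticOn_riemannZeta ρ h
  obtain ⟨n, hn⟩ := ENat.ne_top_iff_exists.mp (analyticOrderAt_zeta_ne_top h)
  have hm : riemannZetaZeroOrder ρ = n := by
    rw [riemannZetaZeroOrder, ha.meromorphicOrderAt_eq, ← hn, ENat.map_coe, WithTop.untop₀_coe]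
  rw [← hn, hm, Int.toNat_natCast]

/-- `Γ_ℝ(s)ζ(s)/(s−ρ)^l` (filled in) is analytic at every non-trivial zero `ρ′` (`ρ` a non-trivial
zero, `l ≤ m_ρ`). [cite: Burnol2004b, Thm. 3.3 (arXiv:math/0203120v7 p. 7, TeX l.566–578)] -/
theorem analyticAt_completedQuotient {ρ ρ' : ℂ} (hρ : ρ ∈ ZetaZeros.riemannZetaNontrivialZeros)
    {l : ℕ} (hlm : (l : ℤ) ≤ riemannZetaZeroOrder ρ) (hρ' : ρ' ∈ ZetaZeros.riemannZetaNontrivialZeros) :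
    AnalyticAt ℂ (fun s ↦ Gammaℝ s * zetaOverPow ρ l s) ρ' := by
  have hρ1 := ne_one_of_mem hρ
  have hρ'1 := ne_one_of_mem hρ'
  obtain ⟨-, hρ'0, -⟩ := mem_riemannZetaNontrivialZeros_iff_holds.1 hρ'
  have hΓ : AnalyticAt ℂ Gammaℝ ρ' := by
    have h := (differentiable_Gammaℝ_inv.analyticAt ρ').inv
      (inv_ne_zero (Gammaℝ_ne_zero_of_re_pos hρ'0))
    have e : (fun z : ℂ ↦ (Gammaℝ z)⁻¹)⁻¹ = Gammaℝ := by funext z; simp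
    rwa [e] at h
  have hZ : AnalyticAt ℂ (zetaOverPow ρ l) ρ' :=
    (differentiableOn_zetaOverPow hρ1 (natCast_le_analyticOrderAt_zeta hρ1 hlm)).analyticAt
      (isOpen_ne.mem_nhds hρ'1)
  exact hΓ.mul hZ

/-- **Order at `ρ′ ≠ ρ`**: `Γ_ℝ(s)ζ(s)/(s−ρ)^l` vanishes at a non-trivial zero `ρ′ ≠ ρ` to order
exactly `m_{ρ′}` (`Γ_ℝ` and `(s−ρ)^{−l}` are analytic and non-zero there; any `ρ`, `l`). [cite: Burnol2004b, Thm. 3.3 (arXiv:math/0203120v7 p. 7, TeX l.566–578)] -/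
theorem analyticOrderAt_completedQuotient_of_ne {ρ ρ' : ℂ} {l : ℕ}
    (hρ' : ρ' ∈ ZetaZeros.riemannZetaNontrivialZeros) (hne : ρ' ≠ ρ) :
    analyticOrderAt (fun s ↦ Gammaℝ s * zetaOverPow ρ l s) ρ' =
      ((riemannZetaZeroOrder ρ').toNat : ℕ∞) := by
  have hρ'1 := ne_one_of_mem hρ'
  obtain ⟨-, hρ'0, -⟩ := mem_riemannZetaNontrivialZeros_iff_holds.1 hρ'
  have hζ : AnalyticAt ℂ riemannZeta ρ' := analyticOn_riemannZeta ρ' hρ'1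
  -- near `ρ'`: `Γ_ℝ(s)ζ(s)/(s−ρ)^l = (Γ_ℝ(s)((s−ρ)^l)⁻¹) · ζ(s)`
  have hev : (fun s ↦ Gammaℝ s * zetaOverPow ρ l s) =ᶠ[𝓝 ρ']
      (fun s ↦ Gammaℝ s * ((s - ρ) ^ l)⁻¹) * riemannZeta := by
    filter_upwards [isOpen_ne.mem_nhds hne] with s hs
    rw [Pi.mul_apply, zetaOverPow_of_ne hs, div_eq_mul_inv]
    ring
  have hΓ : AnalyticAt ℂ Gammaℝ ρ' := by
    have h := (differentiable_Gammaℝ_inv.analyticAt ρ').inv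
      (inv_ne_zero (Gammaℝ_ne_zero_of_re_pos hρ'0))
    have e : (fun z : ℂ ↦ (Gammaℝ z)⁻¹)⁻¹ = Gammaℝ := by funext z; simp
    rwa [e] at h
  have hu : AnalyticAt ℂ (fun s ↦ Gammaℝ s * ((s - ρ) ^ l)⁻¹) ρ' :=
    hΓ.mul (((analyticAt_id.sub analyticAt_const).pow l).inv (pow_ne_zero _ (sub_ne_zero.2 hne)))
  have hu0 : analyticOrderAt (fun s ↦ Gammaℝ s * ((s - ρ) ^ l)⁻¹) ρ' = 0 := by
    rw [hu.analyticOrderAt_eq_zero]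
    exact mul_ne_zero (Gammaℝ_ne_zero_of_re_pos hρ'0) (inv_ne_zero (pow_ne_zero _ (sub_ne_zero.2 hne)))
  rw [analyticOrderAt_congr hev, analyticOrderAt_mul hu hζ, hu0, zero_add, analyticOrderAt_zeta_eq hρ'1]

/-- **Order at `ρ′ = ρ`**: `Γ_ℝ(s)ζ(s)/(s−ρ)^l` vanishes at `ρ` to order exactly `m_ρ − l`
(`ζ(s) = (s−ρ)^l · [ζ(s)/(s−ρ)^l]` and orders add). [cite: Burnol2004b, Thm. 3.3 (arXiv:math/0203120v7 p. 7, TeX l.566–578)] -/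
theorem analyticOrderAt_completedQuotient_self {ρ : ℂ} (hρ : ρ ∈ ZetaZeros.riemannZetaNontrivialZeros)
    {l : ℕ} (hl : 1 ≤ l) (hlm : (l : ℤ) ≤ riemannZetaZeroOrder ρ) :
    analyticOrderAt (fun s ↦ Gammaℝ s * zetaOverPow ρ l s) ρ =
      (((riemannZetaZeroOrder ρ).toNat - l : ℕ) : ℕ∞) := by
  have hρ1 := ne_one_of_mem hρ
  obtain ⟨hζ0, hρ0, -⟩ := mem_riemannZetaNontrivialZeros_iff_holds.1 hρ
  have hζ : AnalyticAt ℂ riemannZeta ρ := analyticOn_riemannZeta ρ hρ1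
  have hZ : AnalyticAt ℂ (zetaOverPow ρ l) ρ :=
    analyticAt_zetaOverPow hρ1 (natCast_le_analyticOrderAt_zeta hρ1 hlm)
  have hΓ : AnalyticAt ℂ Gammaℝ ρ := by
    have h := (differentiable_Gammaℝ_inv.analyticAt ρ).inv
      (inv_ne_zero (Gammaℝ_ne_zero_of_re_pos hρ0))
    have e : (fun z : ℂ ↦ (Gammaℝ z)⁻¹)⁻¹ = Gammaℝ := by funext z; simp
    rwa [e] at h
  -- `ζ = (· − ρ)^l · zetaOverPow ρ l` everywhere
  have hfac : riemannZeta = (fun s ↦ (s - ρ) ^ l) * zetaOverPow ρ l := by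
    funext s
    rw [Pi.mul_apply]
    by_cases hs : s = ρ
    · rw [hs, hζ0, sub_self, zero_pow (by omega), zero_mul]
    · rw [zetaOverPow_of_ne hs, mul_div_cancel₀ _ (pow_ne_zero _ (sub_ne_zero.2 hs))]
  have hmono : analyticOrderAt (fun s : ℂ ↦ (s - ρ) ^ l) ρ = l := by
    have : (fun s : ℂ ↦ (s - ρ) ^ l) = (· - ρ) ^ l := rfl
    rw [this, analyticOrderAt_centeredMonomial]
  have hsum : ((riemannZetaZeroOrder ρ).toNat : ℕ∞) = l + analyticOrderAt (zetaOverPow ρ l) ρ := by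
    rw [← analyticOrderAt_zeta_eq hρ1, ← hmono]
    conv_lhs => rw [hfac]
    exact analyticOrderAt_mul ((analyticAt_id.sub analyticAt_const).pow l) hZ
  -- solve for the order of the quotient
  have hne : analyticOrderAt (zetaOverPow ρ l) ρ ≠ ⊤ := by
    intro h; rw [h, add_top] at hsum; exact ENat.coe_ne_top _ hsum
  obtain ⟨n, hn⟩ := ENat.ne_top_iff_exists.mp hne
  have hn' : (riemannZetaZeroOrder ρ).toNat = l + n := by
    rw [← hn] at hsum; exact_mod_cast hsum
  have hprod : analyticOrderAt (fun s ↦ Gammaℝ s * zetaOverPow ρ l s) ρ =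
      analyticOrderAt (zetaOverPow ρ l) ρ := by
    have : (fun s ↦ Gammaℝ s * zetaOverPow ρ l s) = Gammaℝ * zetaOverPow ρ l := rfl
    rw [this, analyticOrderAt_mul hΓ hZ, (hΓ.analyticOrderAt_eq_zero).2 (Gammaℝ_ne_zero_of_re_pos hρ0),
      zero_add]
  rw [hprod, ← hn]
  congr 1
  omega

/-! ## The clauses of Thm. 3.3 -/

/-- **Thm. 3.3 (i)** (conjunct 1 of `Burnol2004b_thm3_3`, verbatim): every `ζ(s)/(s−ρ)^l`,
`1 ≤ l ≤ m_ρ`, belongs to `L̂_1`. [cite: Burnol2004b, Thm. 3.3 (arXiv:math/0203120v7 p. 7, TeX l.587–594)] -/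
theorem Burnol2004b_thm3_3_i : ∀ p : ZetaZeroIndex, ∃ v, IsZetaQuotientVector p.1.1 (p.1.2 + 1) v :=
  fun p ↦ ⟨zetaQuotientSystem p, isZetaQuotientVector_zetaQuotientSystem p⟩

/-- **Thm. 3.3 (iv)** (conjunct 4 of `Burnol2004b_thm3_3`, verbatim): `[v_{ρ,l}, Y¹_{ρ′,k}] = 0` for
`ρ′ ≠ ρ` (`Γ_ℝ(s)ζ(s)/(s−ρ)^l` vanishes at `ρ′` to order `m_{ρ′} > k`).
[cite: Burnol2004b, Thm. 3.3 (arXiv:math/0203120v7 p. 7, TeX l.566–594)] -/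
theorem Burnol2004b_thm3_3_iv :
    ∀ p q : ZetaZeroIndex, q.1.1 ≠ p.1.1 →
      ∫ t in Ioi (0 : ℝ), zetaQuotientSystem p t * burnolYSystem 1 q t = 0 := by
  intro p q hne
  rw [pairing_eq_iteratedDeriv]
  have hΛ := analyticAt_completedQuotient p.2.1 (index_succ_le p) q.2.1
  have hord := analyticOrderAt_completedQuotient_of_ne (l := p.1.2 + 1) q.2.1 hne
  have hk : q.1.2 < (riemannZetaZeroOrder q.1.1).toNat := by
    have := q.2.2; omega
  exact (natCast_le_analyticOrderAt_iff_iteratedDeriv_eq_zero hΛ).1 hord.symm.le q.1.2 hk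

/-- **Thm. 3.3 (v)** (conjunct 5 of `Burnol2004b_thm3_3`, verbatim): `[v_{ρ,l}, Y¹_{ρ,k}] = 0` for
`k + l < m_ρ` (order `m_ρ − l > k` at `ρ`). [cite: Burnol2004b, Thm. 3.3 (arXiv:math/0203120v7 p. 7, TeX l.566–594)] -/
theorem Burnol2004b_thm3_3_v :
    ∀ p q : ZetaZeroIndex, q.1.1 = p.1.1 → (q.1.2 : ℤ) + p.1.2 + 1 < riemannZetaZeroOrder p.1.1 →
      ∫ t in Ioi (0 : ℝ), zetaQuotientSystem p t * burnolYSystem 1 q t = 0 := by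
  intro p q heq hlt
  rw [pairing_eq_iteratedDeriv, heq]
  have hΛ := analyticAt_completedQuotient p.2.1 (index_succ_le p) p.2.1
  have hord := analyticOrderAt_completedQuotient_self p.2.1 (Nat.succ_le_succ (Nat.zero_le _))
    (index_succ_le p)
  have hk : q.1.2 < (riemannZetaZeroOrder p.1.1).toNat - (p.1.2 + 1) := by omega
  exact (natCast_le_analyticOrderAt_iff_iteratedDeriv_eq_zero hΛ).1 hord.symm.le q.1.2 hk

/-- **Thm. 3.3 (vi)** (conjunct 6 of `Burnol2004b_thm3_3`, verbatim): `[v_{ρ,l}, Y¹_{ρ,k}] ≠ 0` for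
`k + l = m_ρ` (the leading Taylor coefficient at a zero of exact order `m_ρ − l = k`) — the
"triangular" non-degeneracy from which the dual system is read off.
[cite: Burnol2004b, Thm. 3.3 (arXiv:math/0203120v7 p. 7, TeX l.566–594)] -/
theorem Burnol2004b_thm3_3_vi :
    ∀ p q : ZetaZeroIndex, q.1.1 = p.1.1 → (q.1.2 : ℤ) + p.1.2 + 1 = riemannZetaZeroOrder p.1.1 →
      ∫ t in Ioi (0 : ℝ), zetaQuotientSystem p t * burnolYSystem 1 q t ≠ 0 := by
  intro p q heq hsum
  rw [pairing_eq_iteratedDeriv, heq]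
  have hΛ := analyticAt_completedQuotient p.2.1 (index_succ_le p) p.2.1
  have hord := analyticOrderAt_completedQuotient_self p.2.1 (Nat.succ_le_succ (Nat.zero_le _))
    (index_succ_le p)
  have hk : (riemannZetaZeroOrder p.1.1).toNat - (p.1.2 + 1) = q.1.2 := by omega
  rw [hk] at hord
  exact ((analyticOrderAt_eq_nat_iff_iteratedDeriv_eq_zero hΛ).1 hord).2

end BurnolZetaDuality

end Literature.NumberTheory.LFunctions

end
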